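import Literature.Barriers.AnomalousDissipation.ObukhovCorrsinThresholdGrowingNorms
import Literature.Barriers.AnomalousDissipation.ObukhovCorrsinThresholdNikolskii
import Literature.Analysis.FunctionSpaces.SobolevCommutatorL1
import HarnessLib

/-!
# The Obukhov–Corrsin threshold, Sobolev-velocity corner: `L¹_t B^α_{2,∞}` (⊇ `L¹_t H¹`)
velocities against `L^∞_t B^β_{4,∞}` scalars, and the energy-budget form

Barrier-audit addendum (2026-08-17, gen 13, D-0021) to the named fact
`Literature.Barriers.AnomalousDissipation.DrivasElgindiIyerJeong2022_thm4`
(`Barriers/AnomalousDissipation/ObukhovCorrsinThreshold`, scope caveats (viii)–(ix): the pairing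
`(p,q) = (4,2)` of the scale `θ ∈ B^β_{p,∞}`, `u ∈ B^α_{q,∞}`, `2/p + 1/q = 1`, recorded there on
paper, made a theorem).

In the Constantin–E–Titi flux term `∑ⱼ ∫ ∂ⱼθ̄_ℓ · τ_ℓ(uⱼ,θ)` of Drivas–Elgindi–Iyer–Jeong 2022,
(5.9), pair `∂ⱼθ̄_ℓ ∈ L⁴` with `τ_ℓ ∈ L^{4/3}`:
`‖∂ⱼθ̄_ℓ‖_{L⁴} ≤ (C₁/ℓ) [θ]_{B^β_{4,∞}} ℓ^β` (CET (7) in `L⁴`),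
`‖τ_ℓ(uⱼ,θ)‖_{L^{4/3}} ≤ 2 [u]_{B^α_{2,∞}} ℓ^α [θ]_{B^β_{4,∞}} ℓ^β` (the CET identity, Hölder
`L² · L⁴ ⊂ L^{4/3}` slice by slice, Minkowski–Jensen), while the resolved dissipation is
`κ‖∇θ̄_ℓ‖²_{L²} ≤ κ‖∇θ̄_ℓ‖²_{L⁴}` (unit-volume torus) and the datum cumulant is
`∫ τ_ℓ(θ₀,θ₀) ≤ [θ₀]²_{B^β_{2,∞}} ℓ^{2β} ≤ [θ₀]²_{B^β_{4,∞}} ℓ^{2β}`. Consequently Thm. 4 of the source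
holds — same exponent `κ^{(α+2β-1)/(α+1)}`, same constant — with
`‖u‖_{L¹_t C^{0,α}}` replaced by `‖u‖_{L¹_t B^α_{2,∞}}` (fields bounded at a.e. time, no
uniformity) and the sup-norm Hölder bounds on the scalar replaced by bounds on the Nikol'skii
seminorm of its `L⁴` translation modulus, `[θ₀]_{B^β_{4,∞}} ≤ M`, `ess sup_t [θ(t)]_{B^β_{4,∞}} ≤ M`
(plus the qualitative continuity of the slices that the tree's slice identity is stated for).

THE POINT OF THIS CORNER is `α = 1`: by the `L²` translation estimate
`‖u(· - y) - u‖_{L²} ≤ √d ‖y‖ ‖∇u‖_{L²}` (`Torus.eLpNorm_sub_translate_le`,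
`TorusTranslationEstimate`; `√d` converts the torus sup-metric to the Euclidean one),
`[u]_{B¹_{2,∞}} ≤ √d ‖∇u‖_{L²}`, so the velocity enters quantitatively ONLY THROUGH ITS ENSTROPHY
BUDGET `∫₀ᵀ ‖∇u(t)‖_{L²} dt` — available for every Leray–Hopf family, with no Hölder, Lipschitz or
`BV` information whatsoever (the one other velocity hypothesis is qualitative: `u(t)` bounded for
a.e. `t`, no bound entering — automatic for planar and `2½`-dimensional Leray–Hopf fields, which
are smooth at positive times; it is what the tree's slice identity `PassiveScalarEnergySlice` is
stated for). Re-optimising the scale along families whose budgets grow,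
`∫₀ᵀ‖∇u_j‖_{L²} ≤ B κ_j^{-γ}` (`GrowingNorms`), scalars bounded in `L^∞_t B^β_{4,∞}` uniformly in
`j` carry no anomalous dissipation as soon as `β > γ/(1+γ)`:

* `γ = 1/2` — ANY vanishing-viscosity family of Leray–Hopf fields, bounded at a.e. time, with a
  uniform energy budget `ν_j ∫₀ᵀ‖∇u_j‖²_{L²} ≤ E₀` at fixed Prandtl number (`ν_j = Pr κ_j`;
  `∫₀ᵀ‖∇u_j‖₂ ≤ (T E₀/Pr)^{1/2} κ_j^{-1/2}`): threshold `β > 1/3`. The Obukhov–Corrsin exponent `1/3`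
  is thus a RIGIDITY threshold obtained from the kinetic energy budget alone: a passive scalar
  (the transported third component of a `2½`-dimensional flow, a temperature, a dye) advected by a
  Leray–Hopf family can dissipate anomalously on a window only if
  `sup_j ess sup_t [θ_j(t)]_{B^β_{4,∞}} = ∞` for every `β > 1/3`, i.e. only if its fourth-order
  structure functions admit no bound `S₄^{θ_j(t)}(z) ≤ M⁴|z|^{4β}` uniform in `(j,t,z)` at any
  `4β > 4/3` — the scalar counterpart of the Onsager singularity theorem for Leray solutions
  (`Literature.Barriers.AnomalousDissipation.DrivasEyink2019_lemma1_measurable`, velocity exponent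
  `σ ≤ 1/3` in `L³_t B^σ_{3,∞}`).
* `γ = 1/4` — the regime of crux `ScalarAnomalySteadySourceFormal` of route TwoAndHalfD (planar
  Leray–Hopf fields under ONE steady force with bounded mean energy: `⟨‖∇v_j‖₂²⟩ = O(ν_j^{-1/2})` by
  Alexakis–Doering, §2): threshold `β > 1/5` in `B^β_{4,∞}` — in window form this excludes scalar
  FRONTS of bounded jump and perimeter (`‖δ_z 1_Ω‖⁴_{L⁴} ≍ Per(Ω)|z|`, i.e. `1_Ω ∈ B^{1/4}_{4,∞}`,
  `1/4 > 1/5`), the clause of scope caveat (ix) that was on paper.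
* `γ = 0` — fields bounded in `L¹_t H¹` (planar Leray–Hopf fields on a window from `H¹` data
  under forces with square-integrable curl, `‖ω(t)‖₂ ≤ ‖ω₀‖₂ + t‖curl g‖₂` uniformly in `ν`):
  every `β > 0`.

## Contents

* `SobolevCorner.lintegral_enorm_mul_le_four_fourThirds`, `SobolevCorner.eLpNorm_fourThirds_mul_le`
  — Hölder `L⁴ · L^{4/3} ⊂ L¹` and `L² · L⁴ ⊂ L^{4/3}`, the exponent `4/3` written
  `(2⁻¹ + 4⁻¹)⁻¹`;
* `SobolevCorner.eLpNorm_fourThirds_commutatorRemainder_le`,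
  `SobolevCorner.eLpNorm_fourThirds_commutator_le` — the CET remainder and commutator in `L^{4/3}`,
  `L²` modulus on one factor and `L⁴` modulus on the other;
* `SobolevCorner.neg_integral_conv_mul_flux_le` — the slice bound
  (as `NikolskiiCorner.neg_integral_conv_mul_flux_le_of_sqModulus`);
* `SobolevCorner.eLpNorm_comp_sub_sub_two_le_eGradNormSq` — the `H¹` glue
  `‖u(· - y) - u‖_{L²} ≤ √d ‖y‖ (eGradNormSq u)^{1/2}`, and
  `SobolevCorner.eBesovSupSeminorm_one_two_le` — `[u]_{B¹_{2,∞}} ≤ √d (eGradNormSq u)^{1/2}`;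
* `two_mul_eScalarDissipation_le_sobolevVelocity` — the bound (5.10) at fixed scale `ε`;
* `DrivasElgindiIyerJeong2022_thm4_sobolevVelocity` — the theorem, same shape and constant as
  `DrivasElgindiIyerJeong2022_thm4_holds`;
* `DrivasElgindiIyerJeong2022_thm4_sobolevVelocity.noAnomaly_of_growing_norms` — the family form
  with growing `L¹_t B^α_{2,∞}` norms, threshold `β > (1-α+2γ)/(2+2γ)`;
* `DrivasElgindiIyerJeong2022_thm4_sobolevVelocity.noAnomaly_of_enstrophyBudget` — the
  energy-budget form: slices bounded in `L²` by `U`, `∫₀ᵀ (eGradNormSq (u_j t))^{1/2} dt ≤ B κ_j^{-γ}`,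
  scalars bounded in `B^β_{4,∞}`, `β > γ/(1+γ)` ⇒ no anomaly.

## Mathlib / tree search

Tree: `TorusMollifierEstimates` (`eLpNorm_integral_smul_le_mul`,
`Torus.eLpNorm_convolution_kernel_sub_self_le`, `Torus.eLpNorm_partialDeriv_convolution_kernel_le`,
`Torus.eLpNorm_comp_sub_sub_le_eBesovSupSeminorm` — all in general `Lᵖ`),
`TorusCommutatorEstimate` (`Torus.convolution_mul_sub_mul_convolution`),
`PassiveScalarHolderSlice` (`Torus.integral_mul_inner_gradient_conv_conv_eq_sum`),
`PassiveScalarEnergySlice` (`Torus.integral_conv_mul_flux_eq`), `ObukhovCorrsinThresholdNikolskii`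
(`NikolskiiCorner.integral_sq_sub_integral_convolution_sq_le_of_modulus`),
`ObukhovCorrsinThresholdProofs` (`setLIntegral_Ioo_le_of_ae_le`, `scale_bound`),
`ObukhovCorrsinThresholdGrowingNorms` (`GrowingNorms.tendsto_zero_of_scale_bound`,
`GrowingNorms.exists_scale_exponent`), `TorusTranslationEstimate` (`Torus.eLpNorm_sub_translate_le`),
`TorusMaximalLipschitz` (`Torus.norm_reprc_le_sqrt_card_mul_norm`). Mathlib: Hölder
`eLpNorm_smul_le_mul_eLpNorm` with `ENNReal.HolderTriple.of`, exponent comparison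
`eLpNorm_le_eLpNorm_of_exponent_le`; no commutator estimates. Literature search (gen-13 audit):
the `(4,2)` pairing is the inviscid conservation class of Akramov–Wiedemann 2019, Thm. 1 and of
De Rosa–Drivas–Inversi–Isett 2025, Thm. 5.3 (`1/p + 2/s ≤ 1` at `(p,s) = (2,4)`); no printed
statement of the energy-budget (`γ = 1/2`, `β > 1/3`) form for scalars advected by Leray–Hopf
families was found (arXiv, local citation graph of Drivas–Elgindi–Iyer–Jeong 2022 and of
Drivas–Eyink 2019; OpenAlex and Semantic Scholar rate-limited that day).

## References

* T. D. Drivas, T. M. Elgindi, G. Iyer, I.-J. Jeong, Arch. Ration. Mech. Anal. 243 (2022)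
  1151–1180, Thm. 4 and its proof, §5, (5.8)–(5.10) (arXiv:1911.03271, pp. 17–18). Bib key
  `DrivasEtAl2022`.
* I. Akramov, E. Wiedemann, Nonlinear Anal. 179 (2019) 254–269, Thm. 1 (arXiv:1805.05683). Bib key
  `AkramovWiedemann2019`.
* P. Constantin, W. E, E. S. Titi, Comm. Math. Phys. 165 (1994), 207–209, (6)–(11). Bib key
  `ConstantinETiti1994`.
* T. D. Drivas, G. L. Eyink, Nonlinearity 32 (2019) 4465–4482, Lemma 1 and Thm. 1
  (arXiv:1710.05205). Bib key `DrivasEyink2019`.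
* R. J. DiPerna, P.-L. Lions, Invent. Math. 98 (1989), Lemma II.1 (the `W^{1,2}` translation
  estimate). Bib key `DiPernaLions1989Invent`.
* A. Alexakis, C. R. Doering, Phys. Lett. A 359 (2006) 652–657, §2. Bib key `AlexakisDoering2006PLA`.
-/

open MeasureTheory Set Filter Topology Function
open scoped ENNReal NNReal Convolution InnerProductSpace

noncomputable section

namespace Literature.Barriers.AnomalousDissipation

open Literature.Analysis Literature.Analysis.FunctionSpaces Literature.Analysis.FluidPDE

namespace SobolevCorner

variable {d : Type*} [Fintype d]

/-! ## The exponents `2`, `4` and `4/3 = (2⁻¹ + 4⁻¹)⁻¹` -/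

/-- `1/4 + 1/4 = 1/2` in `ℝ≥0∞`. [folklore] -/
theorem inv_four_add_inv_four : (4 : ℝ≥0∞)⁻¹ + 4⁻¹ = 2⁻¹ := by
  have h4 : (4 : ℝ≥0∞) = 2 * 2 := by norm_num
  rw [h4, ENNReal.mul_inv (Or.inl two_ne_zero) (Or.inl ENNReal.ofNat_ne_top), ← mul_add,
    ENNReal.inv_two_add_inv_two, mul_one]

/-- `1/2 + 1/4 ≤ 1` in `ℝ≥0∞`. [folklore] -/
theorem inv_two_add_inv_four_le_one : (2 : ℝ≥0∞)⁻¹ + 4⁻¹ ≤ 1 := by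
  calc (2 : ℝ≥0∞)⁻¹ + 4⁻¹ ≤ 2⁻¹ + 2⁻¹ := by
        gcongr
        norm_num
    _ = 1 := ENNReal.inv_two_add_inv_two

/-- `1 ≤ 4/3`, the exponent written `(2⁻¹ + 4⁻¹)⁻¹`. [folklore] -/
theorem one_le_fourThirds : (1 : ℝ≥0∞) ≤ ((2 : ℝ≥0∞)⁻¹ + 4⁻¹)⁻¹ :=
  ENNReal.one_le_inv.2 inv_two_add_inv_four_le_one

/-- `4/3 < ∞`, the exponent written `(2⁻¹ + 4⁻¹)⁻¹`. [folklore] -/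
theorem fourThirds_ne_top : ((2 : ℝ≥0∞)⁻¹ + 4⁻¹)⁻¹ ≠ ⊤ := by
  rw [Ne, ENNReal.inv_eq_top]
  exact (lt_of_lt_of_le (ENNReal.inv_pos.2 ENNReal.ofNat_ne_top) le_self_add).ne'

/-- `1/4 + (1/2 + 1/4) = 1`: `4` and `4/3` are Hölder conjugate. [folklore] -/
theorem holderTriple_four_fourThirds : ENNReal.HolderTriple 4 (((2 : ℝ≥0∞)⁻¹ + 4⁻¹)⁻¹) 1 where
  inv_add_inv_eq_inv := by
    rw [inv_inv, inv_one, add_comm (2 : ℝ≥0∞)⁻¹, ← add_assoc, inv_four_add_inv_four,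
      ENNReal.inv_two_add_inv_two]

/-- Hölder `L⁴ · L^{4/3} ⊂ L¹` for real functions: `∫ |f g| ≤ ‖f‖_{L⁴} ‖g‖_{L^{4/3}}`. [folklore] -/
theorem lintegral_enorm_mul_le_four_fourThirds {X : Type*} [MeasurableSpace X] {μ : Measure X}
    {f g : X → ℝ} (hf : AEStronglyMeasurable f μ) (hg : AEStronglyMeasurable g μ) :
    ∫⁻ x, ‖f x * g x‖ₑ ∂μ ≤ eLpNorm f 4 μ * eLpNorm g (((2 : ℝ≥0∞)⁻¹ + 4⁻¹)⁻¹) μ := by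
  haveI := holderTriple_four_fourThirds
  have h := @eLpNorm_smul_le_mul_eLpNorm _ _ _ _ μ _ _ _ _ 4 (((2 : ℝ≥0∞)⁻¹ + 4⁻¹)⁻¹) 1 g hg f hf _
  rw [eLpNorm_one_eq_lintegral_enorm] at h
  exact h

/-- Hölder `L² · L⁴ ⊂ L^{4/3}` for real functions: `‖f g‖_{L^{4/3}} ≤ ‖f‖_{L²} ‖g‖_{L⁴}`. [folklore] -/
theorem eLpNorm_fourThirds_mul_le {X : Type*} [MeasurableSpace X] {μ : Measure X}
    {f g : X → ℝ} (hf : AEStronglyMeasurable f μ) (hg : AEStronglyMeasurable g μ) :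
    eLpNorm (fun x => f x * g x) (((2 : ℝ≥0∞)⁻¹ + 4⁻¹)⁻¹) μ ≤ eLpNorm f 2 μ * eLpNorm g 4 μ := by
  haveI : ENNReal.HolderTriple 2 4 (((2 : ℝ≥0∞)⁻¹ + 4⁻¹)⁻¹) := ENNReal.HolderTriple.of 2 4
  exact @eLpNorm_smul_le_mul_eLpNorm _ _ _ _ μ _ _ _ _ 2 4 (((2 : ℝ≥0∞)⁻¹ + 4⁻¹)⁻¹) g hg f hf _

/-! ## The Constantin–E–Titi commutator in `L^{4/3}` -/

/-- **The CET remainder in `L^{4/3}`** (mixed form: `L²` modulus for `f`, `L⁴` modulus for `g`):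
if the `L²` translation modulus of `f` at scale `ε` is at most `A_f` and the `L⁴` translation
modulus of `g` is at most `A_g`, then `‖r_ε(f,g)‖_{L^{4/3}} ≤ A_f A_g`,
`r_ε(f,g)(x) = ∫ k_ε(y) (f(x-y) - f(x)) (g(x-y) - g(x)) dy` (Hölder slice by slice, then
Minkowski–Jensen with the unit-mass kernel). [folklore] -/
theorem eLpNorm_fourThirds_commutatorRemainder_le {f g : UnitAddTorus d → ℝ}
    (hfm : AEStronglyMeasurable f volume) (hgm : AEStronglyMeasurable g volume)
    {ε : ℝ} (hε : 0 < ε) (hε' : ε ≤ 1 / 4) {Af Ag : ℝ≥0∞}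
    (hAf : ∀ y : UnitAddTorus d, ‖y‖ ≤ ε → eLpNorm (fun x => f (x - y) - f x) 2 volume ≤ Af)
    (hAg : ∀ y : UnitAddTorus d, ‖y‖ ≤ ε → eLpNorm (fun x => g (x - y) - g x) 4 volume ≤ Ag) :
    eLpNorm (fun x => ∫ y, Torus.kernel ε y * ((f (x - y) - f x) * (g (x - y) - g x)))
      (((2 : ℝ≥0∞)⁻¹ + 4⁻¹)⁻¹) volume ≤ Af * Ag := by
  have h := eLpNorm_integral_smul_le_mul (F := ℝ) (Torus.continuous_kernel hε hε').aestronglyMeasurable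
    (Torus.aestronglyMeasurable_diff_mul_diff hfm hgm) one_le_fourThirds fourThirds_ne_top
    (A := Af * Ag) (Eventually.of_forall fun y hy => ?_)
  · rw [Torus.lintegral_enorm_kernel hε hε', one_mul] at h
    exact h
  · have hy' : ‖y‖ ≤ ε := (mem_ball_zero_iff.1 (Torus.support_kernel_subset hε hy)).le
    have hfy : AEStronglyMeasurable (fun x => f (x - y) - f x) volume :=
      (hfm.comp_quasiMeasurePreserving
        (measurePreserving_sub_right volume y).quasiMeasurePreserving).sub hfm
    have hgy : AEStronglyMeasurable (fun x => g (x - y) - g x) volume :=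
      (hgm.comp_quasiMeasurePreserving
        (measurePreserving_sub_right volume y).quasiMeasurePreserving).sub hgm
    exact (eLpNorm_fourThirds_mul_le hfy hgy).trans (mul_le_mul' (hAf y hy') (hAg y hy'))

/-- **The Constantin–E–Titi commutator in `L^{4/3}`** (mixed form: `L²` modulus `A_f` for the
bounded measurable factor `f`, `L⁴` modulus `A_g` for the continuous factor `g`):
`‖(fg) ⋆ k_ε - (f ⋆ k_ε)(g ⋆ k_ε)‖_{L^{4/3}} ≤ 2 A_f A_g` (the CET identity
`τ = r_ε(f,g) - (f - f ⋆ k_ε)(g - g ⋆ k_ε)`, the `L^{4/3}` remainder bound, CET (6) in `L²` for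
`f` and in `L⁴` for `g`, and Hölder `L² · L⁴ ⊂ L^{4/3}`). [folklore] -/
theorem eLpNorm_fourThirds_commutator_le {f g : UnitAddTorus d → ℝ} (hfi : Integrable f volume)
    (hgc : Continuous g) (hfg : Integrable (fun x => f x * g x) volume) {ε : ℝ} (hε : 0 < ε)
    (hε' : ε ≤ 1 / 4) {Af Ag : ℝ≥0∞}
    (hAf : ∀ y : UnitAddTorus d, ‖y‖ ≤ ε → eLpNorm (fun x => f (x - y) - f x) 2 volume ≤ Af)
    (hAg : ∀ y : UnitAddTorus d, ‖y‖ ≤ ε → eLpNorm (fun x => g (x - y) - g x) 4 volume ≤ Ag) :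
    eLpNorm (fun x => ((fun y => f y * g y) ⋆ Torus.kernel ε) x -
        (f ⋆ Torus.kernel ε) x * (g ⋆ Torus.kernel ε) x) (((2 : ℝ≥0∞)⁻¹ + 4⁻¹)⁻¹) volume ≤
      2 * (Af * Ag) := by
  have hk := Torus.continuous_kernel (d := d) hε hε'
  have hgi : Integrable g volume := hgc.integrable_unitAddTorus
  set r : UnitAddTorus d → ℝ := fun x => ∫ y, Torus.kernel ε y * ((f (x - y) - f x) * (g (x - y) - g x))
    with hr
  set ef : UnitAddTorus d → ℝ := fun x => f x - (f ⋆ Torus.kernel ε) x with hef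
  set eg : UnitAddTorus d → ℝ := fun x => g x - (g ⋆ Torus.kernel ε) x with heg
  have hfk : Continuous (f ⋆ Torus.kernel ε) := Torus.continuous_convolution hfi hk
  have hgk : Continuous (g ⋆ Torus.kernel ε) := Torus.continuous_convolution hgi hk
  have hrm : AEStronglyMeasurable r volume := by
    have hΦ : AEStronglyMeasurable (uncurry fun x y : UnitAddTorus d =>
        Torus.kernel ε y * ((f (x - y) - f x) * (g (x - y) - g x)))
        ((volume : Measure (UnitAddTorus d)).prod volume) :=
      (hk.aestronglyMeasurable.comp_snd (f := fun y : UnitAddTorus d => Torus.kernel ε y)).mul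
        (Torus.aestronglyMeasurable_diff_mul_diff hfi.aestronglyMeasurable hgc.aestronglyMeasurable)
    exact hΦ.integral_prod_right'
  have hefm : AEStronglyMeasurable ef volume := hfi.aestronglyMeasurable.sub hfk.aestronglyMeasurable
  have hegc : Continuous eg := hgc.sub hgk
  -- the identity, as functions
  have hfun : (fun x => ((fun y => f y * g y) ⋆ Torus.kernel ε) x -
      (f ⋆ Torus.kernel ε) x * (g ⋆ Torus.kernel ε) x) = r - fun x => ef x * eg x := by
    funext x
    rw [Torus.convolution_mul_sub_mul_convolution hfi hgi hfg hε hε' x]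
    rfl
  -- the remainder
  have h1 : eLpNorm r (((2 : ℝ≥0∞)⁻¹ + 4⁻¹)⁻¹) volume ≤ Af * Ag :=
    eLpNorm_fourThirds_commutatorRemainder_le hfi.aestronglyMeasurable hgc.aestronglyMeasurable hε hε'
      hAf hAg
  -- the product of the two errors
  have hef2 : eLpNorm ef 2 volume ≤ Af := by
    have h := Torus.eLpNorm_convolution_kernel_sub_self_le hfi hε hε' (p := 2) one_le_two
      ENNReal.ofNat_ne_top hAf
    rw [← eLpNorm_neg]
    convert h using 2
    funext x
    simp [hef]
  have heg4 : eLpNorm eg 4 volume ≤ Ag := by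
    have h := Torus.eLpNorm_convolution_kernel_sub_self_le hgi hε hε' (p := 4) (by norm_num)
      ENNReal.ofNat_ne_top hAg
    rw [← eLpNorm_neg]
    convert h using 2
    funext x
    simp [heg]
  have h2 : eLpNorm (fun x => ef x * eg x) (((2 : ℝ≥0∞)⁻¹ + 4⁻¹)⁻¹) volume ≤ Af * Ag :=
    (eLpNorm_fourThirds_mul_le hefm hegc.aestronglyMeasurable).trans (mul_le_mul' hef2 heg4)
  rw [hfun]
  calc eLpNorm (r - fun x => ef x * eg x) (((2 : ℝ≥0∞)⁻¹ + 4⁻¹)⁻¹) volume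
      ≤ eLpNorm r (((2 : ℝ≥0∞)⁻¹ + 4⁻¹)⁻¹) volume +
          eLpNorm (fun x => ef x * eg x) (((2 : ℝ≥0∞)⁻¹ + 4⁻¹)⁻¹) volume :=
        eLpNorm_sub_le hrm (hefm.mul hegc.aestronglyMeasurable) one_le_fourThirds
    _ ≤ Af * Ag + Af * Ag := add_le_add h1 h2
    _ = 2 * (Af * Ag) := by rw [two_mul]

/-- **`L⁴` moduli dominate `L²` moduli** on the unit-volume torus:
`‖f(· - y) - f‖_{L²} ≤ ‖f(· - y) - f‖_{L⁴}` (exponent comparison on a probability space). [folklore] -/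
theorem eLpNorm_comp_sub_sub_two_le_four {f : UnitAddTorus d → ℝ} (hfm : AEStronglyMeasurable f volume)
    (y : UnitAddTorus d) :
    eLpNorm (fun x => f (x - y) - f x) 2 volume ≤ eLpNorm (fun x => f (x - y) - f x) 4 volume := by
  have hfy : AEStronglyMeasurable (fun x => f (x - y) - f x) volume :=
    (hfm.comp_quasiMeasurePreserving
      (measurePreserving_sub_right volume y).quasiMeasurePreserving).sub hfm
  exact eLpNorm_le_eLpNorm_of_exponent_le (by norm_num) hfy

/-! ## The slice bound: `L²` moduli on the velocity, `L⁴` moduli on the scalar -/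

section Slice

variable [DecidableEq d] {δ : UnitAddTorus d → ℝ} {v : UnitAddTorus d → EuclideanSpace ℝ d} {ε Cv : ℝ}

/-- **The slice bound, Sobolev-velocity corner** (barrier audit 2026-08-17, gen 13; scope caveats
(viii)–(ix) of `DrivasElgindiIyerJeong2022_thm4`, the pairing `(p,q) = (4,2)`): as
`Torus.neg_integral_conv_mul_flux_le_of_holderWith`, but the continuous scalar slice `δ` enters
through a bound on its `L⁴` translation modulus at scale `ε`, `‖δ(· - y) - δ‖_{L⁴} ≤ C_θ ε^β` for
`‖y‖ ≤ ε`, and the bounded velocity slice `v` through a bound `A_v < ∞` on the `L²` translation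
moduli of its coordinates, `‖vⱼ(· - y) - vⱼ‖_{L²} ≤ A_v` for `‖y‖ ≤ ε`:
`-∫ A G ≤ d · P · Q + κ · d · P²` with `P = (C₁/ε) C_θ ε^β ≥ ‖∂ⱼA‖_{L⁴} ≥ ‖∂ⱼA‖_{L²}` and
`Q = 2 A_v C_θ ε^β ≥ ‖τⱼ‖_{L^{4/3}}` — the flux in commutator form `∑ⱼ ∫ ∂ⱼA τⱼ` paired by Hölder
`L⁴ × L^{4/3}`. [folklore] -/
theorem neg_integral_conv_mul_flux_le (hδ : Continuous δ) {Cθ β : ℝ≥0}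
    (hδN : ∀ y : UnitAddTorus d, ‖y‖ ≤ ε →
      eLpNorm (fun x => δ (x - y) - δ x) 4 volume ≤ ENNReal.ofReal (Cθ * ε ^ (β : ℝ)))
    (hv : AEStronglyMeasurable v volume) (hCv : ∀ y, ‖v y‖ ≤ Cv)
    (hdiv : FunctionSpaces.Torus.IsWeaklyDivFree v) (hε : 0 < ε) (hε' : ε ≤ 1 / 4)
    {Av : ℝ≥0∞} (hAv' : Av ≠ ⊤)
    (hAv : ∀ j, ∀ y : UnitAddTorus d, ‖y‖ ≤ ε → eLpNorm (fun x => v (x - y) j - v x j) 2 volume ≤ Av)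
    {κ : ℝ} (hκ : 0 ≤ κ) :
    -(∫ x, (δ ⋆ FunctionSpaces.Torus.kernel ε) x * ∫ y, δ y *
        (-⟪v y, FunctionSpaces.Torus.gradient (FunctionSpaces.Torus.kernel ε) (x - y)⟫_ℝ +
          κ * FunctionSpaces.Torus.laplacian (FunctionSpaces.Torus.kernel ε) (x - y))) ≤
      Fintype.card d * (ε⁻¹ * FunctionSpaces.Torus.gradProfileMass d * (Cθ * ε ^ (β : ℝ))) *
          (2 * (Av.toReal * (Cθ * ε ^ (β : ℝ)))) +
        κ * (Fintype.card d * (ε⁻¹ * FunctionSpaces.Torus.gradProfileMass d * (Cθ * ε ^ (β : ℝ))) ^ 2) := by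
  set k : UnitAddTorus d → ℝ := FunctionSpaces.Torus.kernel ε with hk_def
  have hk : FunctionSpaces.Torus.IsSmooth k := FunctionSpaces.Torus.isSmooth_kernel hε hε'
  have hkc : Continuous k := hk.continuous
  have hδi : Integrable δ volume := hδ.integrable_unitAddTorus
  have hA : FunctionSpaces.Torus.IsSmooth (δ ⋆ k) := FunctionSpaces.Torus.isSmooth_convolution hδi hk
  have hA1 : FunctionSpaces.Torus.IsContDiff 1 (δ ⋆ k) := hA.isContDiff (by simp)
  have hvI := fun j => Torus.integrable_apply_mul_of_norm_le hδ hv hCv j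
  rw [Torus.integral_conv_mul_flux_eq hδi hv (Eventually.of_forall hCv) hε hε' κ, neg_sub]
  set P : ℝ := ε⁻¹ * FunctionSpaces.Torus.gradProfileMass d * (Cθ * ε ^ (β : ℝ)) with hP
  set Q : ℝ := 2 * (Av.toReal * (Cθ * ε ^ (β : ℝ))) with hQ
  have hθ0 : 0 ≤ (Cθ : ℝ) * ε ^ (β : ℝ) := by positivity
  have hP0 : 0 ≤ P :=
    mul_nonneg (mul_nonneg (inv_nonneg.2 hε.le) FunctionSpaces.Torus.gradProfileMass_nonneg) hθ0
  have hQ0 : 0 ≤ Q := by positivity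
  -- `‖∂ⱼA‖_{L⁴} ≤ P`
  have hPj : ∀ j, eLpNorm (FunctionSpaces.Torus.partialDeriv j (δ ⋆ k)) 4 volume ≤ ENNReal.ofReal P := by
    intro j
    have h := FunctionSpaces.Torus.eLpNorm_partialDeriv_convolution_kernel_le hδi hε hε' (p := 4)
      (by norm_num) ENNReal.ofNat_ne_top hδN j
    rw [hP, ENNReal.ofReal_mul (mul_nonneg (inv_nonneg.2 hε.le) FunctionSpaces.Torus.gradProfileMass_nonneg)]
    exact h
  -- `‖∂ⱼA‖_{L²} ≤ P` (unit volume)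
  have hDc : ∀ j, Continuous (FunctionSpaces.Torus.partialDeriv j (δ ⋆ k)) := fun j =>
    (hA.partialDeriv j).continuous
  have hPj2 : ∀ j, eLpNorm (FunctionSpaces.Torus.partialDeriv j (δ ⋆ k)) 2 volume ≤ ENNReal.ofReal P :=
    fun j => (eLpNorm_le_eLpNorm_of_exponent_le (by norm_num) (hDc j).aestronglyMeasurable).trans (hPj j)
  -- `‖τⱼ‖_{L^{4/3}} ≤ Q`
  have hQ' : ENNReal.ofReal Q = 2 * (Av * ENNReal.ofReal (Cθ * ε ^ (β : ℝ))) := by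
    rw [hQ, ENNReal.ofReal_mul zero_le_two, ENNReal.ofReal_ofNat, ENNReal.ofReal_mul ENNReal.toReal_nonneg,
      ENNReal.ofReal_toReal hAv']
  have hτ : ∀ j, eLpNorm (fun x => ((fun y => v y j * δ y) ⋆ k) x -
      ((fun y => v y j) ⋆ k) x * (δ ⋆ k) x) (((2 : ℝ≥0∞)⁻¹ + 4⁻¹)⁻¹) volume ≤ ENNReal.ofReal Q := by
    intro j
    rw [hQ']
    exact eLpNorm_fourThirds_commutator_le (hvI j).2.1 hδ (hvI j).2.2 hε hε' (hAv j) hδN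
  -- (a) the transport pairing, by Hölder `L⁴ × L^{4/3}`
  have ha : |∫ y, δ y * ⟪v y, FunctionSpaces.Torus.gradient ((δ ⋆ k) ⋆ k) y⟫_ℝ| ≤ Fintype.card d * P * Q := by
    rw [Torus.integral_mul_inner_gradient_conv_conv_eq_sum hδ hv hCv hdiv hε hε']
    refine (Finset.abs_sum_le_sum_abs _ _).trans ?_
    have hj : ∀ j, |∫ x, FunctionSpaces.Torus.partialDeriv j (δ ⋆ k) x *
        (((fun y => v y j * δ y) ⋆ k) x - ((fun y => v y j) ⋆ k) x * (δ ⋆ k) x)| ≤ P * Q := by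
      intro j
      set τ : UnitAddTorus d → ℝ := fun x =>
        ((fun y => v y j * δ y) ⋆ k) x - ((fun y => v y j) ⋆ k) x * (δ ⋆ k) x with hτdef
      have hτc : Continuous τ :=
        (FunctionSpaces.Torus.continuous_convolution (hvI j).2.2 hkc).sub
          ((FunctionSpaces.Torus.continuous_convolution (hvI j).2.1 hkc).mul hA.continuous)
      have hm : AEStronglyMeasurable (fun x => FunctionSpaces.Torus.partialDeriv j (δ ⋆ k) x * τ x) volume :=
        ((hDc j).mul hτc).aestronglyMeasurable
      have hfin : eLpNorm (FunctionSpaces.Torus.partialDeriv j (δ ⋆ k)) 4 volume *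
          eLpNorm τ (((2 : ℝ≥0∞)⁻¹ + 4⁻¹)⁻¹) volume ≤ ENNReal.ofReal P * ENNReal.ofReal Q :=
        mul_le_mul' (hPj j) (hτ j)
      have hne : ENNReal.ofReal P * ENNReal.ofReal Q ≠ ⊤ :=
        ENNReal.mul_ne_top ENNReal.ofReal_ne_top ENNReal.ofReal_ne_top
      calc |∫ x, FunctionSpaces.Torus.partialDeriv j (δ ⋆ k) x * τ x|
          ≤ ∫ x, |FunctionSpaces.Torus.partialDeriv j (δ ⋆ k) x * τ x| := by
            simpa only [Real.norm_eq_abs] using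
              norm_integral_le_integral_norm (fun x => FunctionSpaces.Torus.partialDeriv j (δ ⋆ k) x * τ x)
        _ = (∫⁻ x, ‖FunctionSpaces.Torus.partialDeriv j (δ ⋆ k) x * τ x‖ₑ).toReal := by
            rw [← integral_norm_eq_lintegral_enorm hm]
            rfl
        _ ≤ (eLpNorm (FunctionSpaces.Torus.partialDeriv j (δ ⋆ k)) 4 volume *
              eLpNorm τ (((2 : ℝ≥0∞)⁻¹ + 4⁻¹)⁻¹) volume).toReal :=
            ENNReal.toReal_mono (ne_top_of_le_ne_top hne hfin)
              (lintegral_enorm_mul_le_four_fourThirds (hDc j).aestronglyMeasurable hτc.aestronglyMeasurable)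
        _ ≤ (ENNReal.ofReal P * ENNReal.ofReal Q).toReal := ENNReal.toReal_mono hne hfin
        _ = P * Q := by rw [ENNReal.toReal_mul, ENNReal.toReal_ofReal hP0, ENNReal.toReal_ofReal hQ0]
    calc ∑ j, |∫ x, FunctionSpaces.Torus.partialDeriv j (δ ⋆ k) x *
          (((fun y => v y j * δ y) ⋆ k) x - ((fun y => v y j) ⋆ k) x * (δ ⋆ k) x)|
        ≤ ∑ _j : d, P * Q := Finset.sum_le_sum fun j _ => hj j
      _ = Fintype.card d * P * Q := by
          rw [Finset.sum_const, Finset.card_univ, nsmul_eq_mul]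
          ring
  -- (b) the resolved dissipation, `∫ ‖∇A‖² = ∑ⱼ ‖∂ⱼA‖²_{L²} ≤ d P²`
  have hb : ∫ x, ‖FunctionSpaces.Torus.gradient (δ ⋆ k) x‖ ^ 2 ≤ Fintype.card d * P ^ 2 := by
    have hpt : ∀ x, ‖FunctionSpaces.Torus.gradient (δ ⋆ k) x‖ ^ 2 =
        ∑ j, FunctionSpaces.Torus.partialDeriv j (δ ⋆ k) x ^ 2 := by
      intro x
      rw [EuclideanSpace.norm_sq_eq]
      refine Finset.sum_congr rfl fun j _ => ?_
      rw [FunctionSpaces.Torus.gradient_apply hA1, Real.norm_eq_abs, sq_abs]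
    have hj : ∀ j, ∫ x, FunctionSpaces.Torus.partialDeriv j (δ ⋆ k) x ^ 2 ≤ P ^ 2 := by
      intro j
      have e := Torus.lintegral_enorm_sq_eq_ofReal_integral_sq (hDc j)
      have h2 : ENNReal.ofReal (∫ x, FunctionSpaces.Torus.partialDeriv j (δ ⋆ k) x ^ 2) ≤ ENNReal.ofReal (P ^ 2) := by
        rw [← e, ← PassiveScalarProofs.eLpNorm_two_pow_two, ENNReal.ofReal_pow hP0]
        gcongr
        exact hPj2 j
      exact (ENNReal.ofReal_le_ofReal_iff (sq_nonneg P)).1 h2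
    calc ∫ x, ‖FunctionSpaces.Torus.gradient (δ ⋆ k) x‖ ^ 2
        = ∫ x, ∑ j, FunctionSpaces.Torus.partialDeriv j (δ ⋆ k) x ^ 2 :=
          integral_congr_ae (Eventually.of_forall hpt)
      _ = ∑ j, ∫ x, FunctionSpaces.Torus.partialDeriv j (δ ⋆ k) x ^ 2 :=
          integral_finsetSum _ fun j _ => ((hDc j).pow 2).integrable_unitAddTorus
      _ ≤ ∑ _j : d, P ^ 2 := Finset.sum_le_sum fun j _ => hj j
      _ = Fintype.card d * P ^ 2 := by
          rw [Finset.sum_const, Finset.card_univ, nsmul_eq_mul]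
  have ha' := (neg_le_abs _).trans ha
  have hb' := mul_le_mul_of_nonneg_left hb hκ
  linarith

end Slice

/-! ## The `H¹` glue: `[u]_{B¹_{2,∞}} ≤ √d ‖∇u‖_{L²}` -/

/-- **The `L²` translation modulus by the enstrophy** (DiPerna–Lions 1989, Lemma II.1, torus form):
for `u ∈ L²(T^d; ℝ^d)` and `y ∈ T^d`,
`‖u(· - y) - u‖_{L²} ≤ √d ‖y‖ (eGradNormSq u)^{1/2}` — the tree's spectral estimate
`Torus.eLpNorm_sub_translate_le` at the centred lift `-reprc y`, whose Euclidean norm is at most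
`√d` times the quotient (sup) norm of `y`. [cite: DiPernaLions1989Invent, Lemma II.1] -/
theorem eLpNorm_comp_sub_sub_two_le_eGradNormSq {u : UnitAddTorus d → EuclideanSpace ℝ d}
    (hu : MemLp u 2 volume) (y : UnitAddTorus d) :
    eLpNorm (fun x => u (x - y) - u x) 2 volume ≤
      ENNReal.ofReal (Real.sqrt (Fintype.card d) * ‖y‖) * Torus.eGradNormSq u ^ (1 / 2 : ℝ) := by
  have h := Torus.eLpNorm_sub_translate_le hu (-Torus.reprc y)
  have hfun : (fun x => u (x + Torus.proj (-Torus.reprc y)) - u x) = fun x => u (x - y) - u x := by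
    funext x
    rw [Torus.proj_neg, Torus.proj_reprc, ← sub_eq_add_neg]
  rw [hfun, norm_neg] at h
  refine h.trans ?_
  gcongr
  exact Torus.norm_reprc_le_sqrt_card_mul_norm y

/-- **`H¹ ⊂ B¹_{2,∞}` quantitatively**: `[u]_{B¹_{2,∞}} ≤ √d (eGradNormSq u)^{1/2}` for
`u ∈ L²(T^d; ℝ^d)` (`eBesovSupSeminorm 1 2`, the Nikol'skii seminorm of the `L²` translation
modulus, intrinsic torus metric). [folklore] -/
theorem eBesovSupSeminorm_one_two_le {u : UnitAddTorus d → EuclideanSpace ℝ d} (hu : MemLp u 2 volume) :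
    eBesovSupSeminorm 1 2 u volume ≤
      ENNReal.ofReal (Real.sqrt (Fintype.card d)) * Torus.eGradNormSq u ^ (1 / 2 : ℝ) := by
  rw [eBesovSupSeminorm_def]
  refine iSup₂_le fun h hh => ?_
  rw [ENNReal.div_le_iff (ofReal_norm_rpow_pos 1 hh).ne' ENNReal.ofReal_ne_top]
  have h1 := eLpNorm_comp_sub_sub_two_le_eGradNormSq hu (-h)
  simp only [sub_neg_eq_add, norm_neg] at h1
  calc eLpNorm (fun x => u (x + h) - u x) 2 volume
      ≤ ENNReal.ofReal (Real.sqrt (Fintype.card d) * ‖h‖) * Torus.eGradNormSq u ^ (1 / 2 : ℝ) := h1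
    _ = ENNReal.ofReal (Real.sqrt (Fintype.card d)) * Torus.eGradNormSq u ^ (1 / 2 : ℝ) *
          ENNReal.ofReal (‖h‖ ^ (1 : ℝ)) := by
        rw [Real.rpow_one, ENNReal.ofReal_mul (Real.sqrt_nonneg _)]
        ring

end SobolevCorner

/-! ## The dissipation bound at a fixed scale, Sobolev-velocity corner -/

/-- **The bound (5.10) at `t = 0`, Sobolev-velocity corner** (barrier audit 2026-08-17, gen 13;
scope caveats (viii)–(ix) of `DrivasElgindiIyerJeong2022_thm4`): as
`DrivasElgindiIyerJeong2022_thm4.two_mul_eScalarDissipation_le`, with the velocity hypothesis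
`u ∈ L¹_t C^{0,α}`, `‖u‖ ≤ K` replaced by slicewise boundedness (no uniformity) and
`u ∈ L¹_t B^α_{2,∞}`, `‖u‖_{L¹_t B^α_{2,∞}} ≤ K` (`MemLpBesovSup 1 α 2`, `eLpBesovSupNorm 1 α 2`), and
the sup-norm Hölder hypotheses on the scalar replaced by `[θ₀]_{B^β_{4,∞}} ≤ M`,
`ess sup_t [θ(t)]_{B^β_{4,∞}} ≤ M` (`eBesovSupSeminorm β 4`) plus the qualitative continuity of `θ₀`
and of `θ(t)` for a.e. `t`. Same right-hand side:
`2κ ∫₀ᵀ ‖∇θ‖²_{L²} ≤ M² ε^{2β} + 2 (2 d C₁ M² ε^{α+2β-1} K + T κ d C₁² M² ε^{2β-2})`.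
[cite: DrivasEtAl2022, proof of Thm. 4, (5.9)–(5.10)] -/
theorem two_mul_eScalarDissipation_le_sobolevVelocity {d : Type*} [Fintype d]
    [DecidableEq d] {T : ℝ} (hT : 0 < T) {α β : ℝ≥0} (hα : 0 < α) (hβ : 0 < β) {K M : ℝ≥0}
    {u : ℝ → UnitAddTorus d → EuclideanSpace ℝ d}
    (hub : ∀ᵐ t ∂((volume : Measure ℝ).restrict (Ioo 0 T)), eSupNorm (u t) < ⊤)
    (hu : MemLpBesovSup 1 (α : ℝ) 2 u volume (Ioo 0 T))
    (huK : eLpBesovSupNorm 1 (α : ℝ) 2 u volume (Ioo 0 T) ≤ K) {θ₀ : UnitAddTorus d → ℝ}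
    (hθ₀c : Continuous θ₀) (hθ₀N : eBesovSupSeminorm (β : ℝ) 4 θ₀ volume ≤ M) {κ : ℝ} (hκ : 0 < κ)
    {θ : ℝ → UnitAddTorus d → ℝ} (hθ : Torus.IsWeakScalarTransportOn T κ u θ₀ θ)
    (henergy : ∀ᵐ t ∂((volume : Measure ℝ).restrict (Ioo 0 T)),
      (∫⁻ x, ‖θ t x‖ₑ ^ 2) + 2 * Torus.eScalarDissipation κ θ 0 t ≤ ∫⁻ x, ‖θ₀ x‖ₑ ^ 2)
    (hcont : ∀ᵐ t ∂((volume : Measure ℝ).restrict (Ioo 0 T)), Continuous (θ t))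
    (hbound : ∀ᵐ t ∂((volume : Measure ℝ).restrict (Ioo 0 T)),
      eBesovSupSeminorm (β : ℝ) 4 (θ t) volume ≤ M)
    {ε : ℝ} (hε : 0 < ε) (hε' : ε ≤ 1 / 4) :
    2 * Torus.eScalarDissipation κ θ 0 T ≤ ENNReal.ofReal
      ((M : ℝ) ^ 2 * ε ^ (2 * (β : ℝ)) +
        2 * ((2 * Fintype.card d * Torus.gradProfileMass d * (M : ℝ) ^ 2 * ε ^ ((α : ℝ) + 2 * β - 1)) * K +
          T * (κ * (Fintype.card d * (Torus.gradProfileMass d ^ 2 * (M : ℝ) ^ 2 * ε ^ (2 * (β : ℝ) - 2)))))) := by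
  -- the `L⁴` modulus at scale `ε` from the Nikol'skii seminorm, and its `L²` consequence
  have modulus : ∀ {f : UnitAddTorus d → ℝ}, eBesovSupSeminorm (β : ℝ) 4 f volume ≤ M →
      ∀ y : UnitAddTorus d, ‖y‖ ≤ ε →
        eLpNorm (fun x => f (x - y) - f x) 4 volume ≤ ENNReal.ofReal (M * ε ^ (β : ℝ)) := by
    intro f hf y hy
    refine (Torus.eLpNorm_comp_sub_sub_le_eBesovSupSeminorm (by exact_mod_cast hβ) hy).trans ?_
    rw [ENNReal.ofReal_mul (NNReal.coe_nonneg M), ENNReal.ofReal_coe_nnreal]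
    exact mul_le_mul_left hf _
  have modulus₂ : ∀ {f : UnitAddTorus d → ℝ}, Continuous f → eBesovSupSeminorm (β : ℝ) 4 f volume ≤ M →
      ∀ y : UnitAddTorus d, ‖y‖ ≤ ε →
        eLpNorm (fun x => f (x - y) - f x) 2 volume ≤ ENNReal.ofReal (M * ε ^ (β : ℝ)) :=
    fun hfc hf y hy => (SobolevCorner.eLpNorm_comp_sub_sub_two_le_four hfc.aestronglyMeasurable y).trans
      (modulus hf y hy)
  have hθ₀i : Integrable θ₀ volume := hθ₀c.integrable_unitAddTorus
  set k : UnitAddTorus d → ℝ := Torus.kernel ε with hk_def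
  have hk : Torus.IsSmooth k := Torus.isSmooth_kernel hε hε'
  -- constants and exponent bookkeeping
  set C₁ : ℝ := Torus.gradProfileMass d with hC₁
  have hC₁0 : 0 ≤ C₁ := Torus.gradProfileMass_nonneg
  set c₁ : ℝ := 2 * Fintype.card d * C₁ * (M : ℝ) ^ 2 * ε ^ ((α : ℝ) + 2 * β - 1) with hc₁
  set c₂ : ℝ := κ * (Fintype.card d * (C₁ ^ 2 * (M : ℝ) ^ 2 * ε ^ (2 * (β : ℝ) - 2))) with hc₂
  have hc₁0 : 0 ≤ c₁ := by positivity
  have hc₂0 : 0 ≤ c₂ := by positivity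
  have i1 : ((M : ℝ) * ε ^ (β : ℝ)) ^ 2 = (M : ℝ) ^ 2 * ε ^ (2 * (β : ℝ)) := by
    rw [mul_pow, ← Real.rpow_natCast (ε ^ (β : ℝ)) 2, ← Real.rpow_mul hε.le]
    congr 2
    push_cast
    ring
  have i2 : ε⁻¹ * ε ^ (β : ℝ) * ε ^ (α : ℝ) * ε ^ (β : ℝ) = ε ^ ((α : ℝ) + 2 * β - 1) := by
    rw [← Real.rpow_neg_one ε, ← Real.rpow_add hε, ← Real.rpow_add hε, ← Real.rpow_add hε]
    congr 1
    ring
  have i3 : (ε⁻¹ * ε ^ (β : ℝ)) ^ 2 = ε ^ (2 * (β : ℝ) - 2) := by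
    rw [← Real.rpow_neg_one ε, ← Real.rpow_add hε, ← Real.rpow_natCast _ 2, ← Real.rpow_mul hε.le]
    congr 1
    push_cast
    ring
  -- Step 1: the slice bound, for a.e. `s`
  have hslice : ∀ᵐ s ∂((volume : Measure ℝ).restrict (Ioo 0 T)),
      -(∫ x, ((θ s) ⋆ k) x * ∫ y, θ s y *
        (-⟪u s y, Torus.gradient k (x - y)⟫_ℝ + κ * Torus.laplacian k (x - y))) ≤
        c₁ * (eBesovSupNorm (α : ℝ) 2 (u s) volume).toReal + c₂ := by
    filter_upwards [hbound, hcont, hu.1, hub, hθ.ae_isWeaklyDivFree, hθ.ae_aestronglyMeasurable_velocity_slice]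
      with s hsM hθsc hsu hsb hdiv hum
    have hCv : ∀ y, ‖u s y‖ ≤ (eSupNorm (u s)).toReal := fun y => by
      rw [← toReal_enorm]
      exact ENNReal.toReal_mono hsb.ne (enorm_le_eSupNorm (u s) y)
    -- the `L²` translation modulus of `u s` at scale `ε`
    set S : ℝ≥0∞ := eBesovSupSeminorm (α : ℝ) 2 (u s) volume with hS
    have hStop : S ≠ ⊤ := hsu.2.ne
    have hNtop : eBesovSupNorm (α : ℝ) 2 (u s) volume ≠ ⊤ :=
      ENNReal.add_ne_top.2 ⟨hsu.1.eLpNorm_ne_top, hStop⟩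
    have hSN : S ≤ eBesovSupNorm (α : ℝ) 2 (u s) volume := le_add_self
    set Av : ℝ≥0∞ := S * ENNReal.ofReal (ε ^ (α : ℝ)) with hAv
    have hAvtop : Av ≠ ⊤ := ENNReal.mul_ne_top hStop ENNReal.ofReal_ne_top
    have hAvj : ∀ j, ∀ y : UnitAddTorus d, ‖y‖ ≤ ε →
        eLpNorm (fun x => u s (x - y) j - u s x j) 2 volume ≤ Av := fun j y hy =>
      (Torus.eLpNorm_apply_comp_sub_sub_le j y 2).trans
        (Torus.eLpNorm_comp_sub_sub_le_eBesovSupSeminorm (by exact_mod_cast hα) hy)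
    have h := SobolevCorner.neg_integral_conv_mul_flux_le hθsc (modulus hsM) hum hCv hdiv hε hε'
      hAvtop hAvj hκ.le
    have hAvR : Av.toReal = S.toReal * ε ^ (α : ℝ) := by
      rw [hAv, ENNReal.toReal_mul, ENNReal.toReal_ofReal (Real.rpow_nonneg hε.le _)]
    have hSle : S.toReal ≤ (eBesovSupNorm (α : ℝ) 2 (u s) volume).toReal :=
      ENNReal.toReal_mono hNtop hSN
    have hS0 : 0 ≤ S.toReal := ENNReal.toReal_nonneg
    calc _ ≤ _ := h
      _ = c₁ * S.toReal + c₂ := by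
          rw [hAvR, hc₁, hc₂, ← i2, ← i3]
          ring
      _ ≤ c₁ * (eBesovSupNorm (α : ℝ) 2 (u s) volume).toReal + c₂ := by gcongr
  -- Step 2: the time integral of the slice bound, in `ℝ≥0∞`
  have hKint : ∫⁻ s in Ioo 0 T, ENNReal.ofReal ((eBesovSupNorm (α : ℝ) 2 (u s) volume).toReal) ≤ K := by
    have e : ∫⁻ s in Ioo 0 T, ENNReal.ofReal ((eBesovSupNorm (α : ℝ) 2 (u s) volume).toReal) =
        eLpBesovSupNorm 1 (α : ℝ) 2 u volume (Ioo 0 T) := by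
      rw [eLpBesovSupNorm, eLpNorm_one_eq_lintegral_enorm]
      refine lintegral_congr fun s => ?_
      exact (Real.enorm_eq_ofReal ENNReal.toReal_nonneg).symm
    rw [e]
    exact huK
  have htime : ∀ t ∈ Ioo 0 T,
      ENNReal.ofReal (∫ s in Ioc 0 t, -(∫ x, ((θ s) ⋆ k) x * ∫ y, θ s y *
        (-⟪u s y, Torus.gradient k (x - y)⟫_ℝ + κ * Torus.laplacian k (x - y)))) ≤
        ENNReal.ofReal c₁ * K + ENNReal.ofReal c₂ * ENNReal.ofReal T := by
    intro t ht
    refine (ofReal_integral_le_lintegral_ofReal _).trans ?_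
    refine (lintegral_mono_set (Ioc_subset_Ioo_right ht.2)).trans ?_
    have hmono : ∫⁻ s in Ioo 0 T, ENNReal.ofReal (-(∫ x, ((θ s) ⋆ k) x * ∫ y, θ s y *
        (-⟪u s y, Torus.gradient k (x - y)⟫_ℝ + κ * Torus.laplacian k (x - y)))) ≤
        ∫⁻ s in Ioo 0 T, (ENNReal.ofReal c₁ * ENNReal.ofReal ((eBesovSupNorm (α : ℝ) 2 (u s) volume).toReal) +
          ENNReal.ofReal c₂) := by
      refine lintegral_mono_ae (hslice.mono fun s hs => ?_)
      have hb0 : 0 ≤ (eBesovSupNorm (α : ℝ) 2 (u s) volume).toReal := ENNReal.toReal_nonneg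
      rw [← ENNReal.ofReal_mul hc₁0, ← ENNReal.ofReal_add (mul_nonneg hc₁0 hb0) hc₂0]
      exact ENNReal.ofReal_le_ofReal hs
    refine hmono.trans ?_
    rw [lintegral_add_right _ measurable_const, lintegral_const_mul' _ _ ENNReal.ofReal_ne_top,
      lintegral_const, Measure.restrict_apply_univ, Real.volume_Ioo, sub_zero]
    gcongr
  -- Step 3: the bound for a.e. `t`
  have hmain : ∀ᵐ t ∂((volume : Measure ℝ).restrict (Ioo 0 T)), 2 * Torus.eScalarDissipation κ θ 0 t ≤
      ENNReal.ofReal ((M : ℝ) ^ 2 * ε ^ (2 * (β : ℝ))) + 2 * (ENNReal.ofReal c₁ * K + ENNReal.ofReal c₂ * ENNReal.ofReal T) := by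
    filter_upwards [henergy, hθ.ae_integral_sq_molInt_eq hθ₀i hk, ae_restrict_mem measurableSet_Ioo,
      hθ.ae_slice_integrable₁] with t hen hid htT hint
    have hθti : Integrable (θ t) volume := hint.1
    have hAc : Continuous ((θ t) ⋆ k) := Torus.continuous_convolution hθti hk.continuous
    -- Young: `‖θ(t) ⋆ k‖₂ ≤ ‖θ(t)‖₂`
    have hY : ∫⁻ x, ‖((θ t) ⋆ k) x‖ₑ ^ 2 ≤ ∫⁻ x, ‖θ t x‖ₑ ^ 2 := by
      rw [← PassiveScalarProofs.eLpNorm_two_pow_two, ← PassiveScalarProofs.eLpNorm_two_pow_two]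
      gcongr
      calc eLpNorm ((θ t) ⋆ k) 2 volume ≤ (∫⁻ y, ‖k y‖ₑ) * eLpNorm (θ t) 2 volume :=
            Torus.eLpNorm_convolution_le hθti.aestronglyMeasurable hk.continuous.aestronglyMeasurable one_le_two
        _ = eLpNorm (θ t) 2 volume := by rw [hk_def, Torus.lintegral_enorm_kernel hε hε', one_mul]
    have e0 : ∫⁻ x, ‖θ₀ x‖ₑ ^ 2 = ENNReal.ofReal (∫ x, θ₀ x ^ 2) :=
      Torus.lintegral_enorm_sq_eq_ofReal_integral_sq hθ₀c
    have eA : ∫⁻ x, ‖((θ t) ⋆ k) x‖ₑ ^ 2 = ENNReal.ofReal (∫ x, ((θ t) ⋆ k) x ^ 2) :=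
      Torus.lintegral_enorm_sq_eq_ofReal_integral_sq hAc
    have h1 : ENNReal.ofReal (∫ x, ((θ t) ⋆ k) x ^ 2) + 2 * Torus.eScalarDissipation κ θ 0 t ≤
        ENNReal.ofReal (∫ x, θ₀ x ^ 2) := by
      rw [← eA, ← e0]
      exact (add_le_add hY le_rfl).trans hen
    have h2 : 2 * Torus.eScalarDissipation κ θ 0 t ≤
        ENNReal.ofReal ((∫ x, θ₀ x ^ 2) - ∫ x, ((θ t) ⋆ k) x ^ 2) := by
      rw [ENNReal.ofReal_sub _ (integral_nonneg fun x => sq_nonneg _)]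
      exact ENNReal.le_sub_of_add_le_left ENNReal.ofReal_ne_top h1
    have h3 : (∫ x, θ₀ x ^ 2) - ∫ x, ((θ t) ⋆ k) x ^ 2 ≤ (M : ℝ) ^ 2 * ε ^ (2 * (β : ℝ)) +
        2 * ∫ s in Ioc 0 t, -(∫ x, ((θ s) ⋆ k) x * ∫ y, θ s y *
          (-⟪u s y, Torus.gradient k (x - y)⟫_ℝ + κ * Torus.laplacian k (x - y))) := by
      rw [hid, integral_neg, ← i1]
      have hc := NikolskiiCorner.integral_sq_sub_integral_convolution_sq_le_of_modulus hθ₀c hε hε'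
        ENNReal.ofReal_ne_top (modulus₂ hθ₀c hθ₀N)
      rw [ENNReal.toReal_ofReal (by positivity)] at hc
      linarith
    calc 2 * Torus.eScalarDissipation κ θ 0 t
        ≤ ENNReal.ofReal ((∫ x, θ₀ x ^ 2) - ∫ x, ((θ t) ⋆ k) x ^ 2) := h2
      _ ≤ ENNReal.ofReal ((M : ℝ) ^ 2 * ε ^ (2 * (β : ℝ)) +
          2 * ∫ s in Ioc 0 t, -(∫ x, ((θ s) ⋆ k) x * ∫ y, θ s y *
            (-⟪u s y, Torus.gradient k (x - y)⟫_ℝ + κ * Torus.laplacian k (x - y)))) :=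
          ENNReal.ofReal_le_ofReal h3
      _ ≤ ENNReal.ofReal ((M : ℝ) ^ 2 * ε ^ (2 * (β : ℝ))) +
          ENNReal.ofReal (2 * ∫ s in Ioc 0 t, -(∫ x, ((θ s) ⋆ k) x * ∫ y, θ s y *
            (-⟪u s y, Torus.gradient k (x - y)⟫_ℝ + κ * Torus.laplacian k (x - y)))) :=
          ENNReal.ofReal_add_le
      _ ≤ _ := by
          rw [ENNReal.ofReal_mul zero_le_two, ENNReal.ofReal_ofNat]
          gcongr
          exact htime t htT
  -- Step 4: from a.e. `t` to `T`
  have h2D : ∀ t, 2 * Torus.eScalarDissipation κ θ 0 t =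
      ∫⁻ s in Ioo 0 t, 2 * (ENNReal.ofReal κ * Torus.eScalarGradNormSq (θ s)) := fun t => by
    rw [Torus.eScalarDissipation, ← lintegral_const_mul' _ _ ENNReal.ofReal_ne_top,
      ← lintegral_const_mul' _ _ ENNReal.ofNat_ne_top]
  have hfin : 2 * Torus.eScalarDissipation κ θ 0 T ≤
      ENNReal.ofReal ((M : ℝ) ^ 2 * ε ^ (2 * (β : ℝ))) + 2 * (ENNReal.ofReal c₁ * K + ENNReal.ofReal c₂ * ENNReal.ofReal T) := by
    rw [h2D]
    refine setLIntegral_Ioo_le_of_ae_le hT ?_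
    filter_upwards [hmain] with t ht
    rwa [h2D] at ht
  refine hfin.trans (le_of_eq ?_)
  rw [ENNReal.ofReal_add (by positivity) (by positivity), ENNReal.ofReal_mul zero_le_two, ENNReal.ofReal_ofNat,
    ENNReal.ofReal_add (by positivity) (by positivity), ENNReal.ofReal_mul hc₁0, ENNReal.ofReal_coe_nnreal,
    ENNReal.ofReal_mul (le_of_lt hT), mul_comm (ENNReal.ofReal T) (ENNReal.ofReal c₂)]

/-! ## The theorem, Sobolev-velocity corner -/

/-- **The Obukhov–Corrsin threshold with an `L²`-Besov velocity and an `L⁴`-Besov scalar**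
(barrier audit 2026-08-17, gen 13: the pairing `(p,q) = (4,2)` of scope caveats (viii)–(ix) of
`DrivasElgindiIyerJeong2022_thm4` made a theorem). Same statement and constant as the named fact
`DrivasElgindiIyerJeong2022_thm4` / `DrivasElgindiIyerJeong2022_thm4_holds` — weak solutions obeying
the energy balance, `0 < κ ≤ κ₀`, dissipation `≤ C κ^{(α+2β-1)/(α+1)}` with
`C = C(d, T, α, β, K, M, κ₀)` — except that (a) the velocity hypothesis `u ∈ L¹(0,T; C^{0,α})`,
`‖u‖_{L¹C^{0,α}} ≤ K` is replaced by: `u(t)` bounded for a.e. `t` (no uniformity) and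
`u ∈ L¹(0,T; B^α_{2,∞})`, `‖u‖_{L¹_t B^α_{2,∞}} ≤ K` (`MemLpBesovSup 1 α 2`, `eLpBesovSupNorm 1 α 2`:
the Nikol'skii space of the `L²` translation modulus, which at `α = 1` contains `H¹`,
`[u]_{B¹_{2,∞}} ≤ √d ‖∇u‖_{L²}`, `SobolevCorner.eBesovSupSeminorm_one_two_le`), and (b) the
sup-norm Hölder bounds on the SCALAR are replaced by `[θ₀]_{B^β_{4,∞}} ≤ M`,
`ess sup_t [θ(t)]_{B^β_{4,∞}} ≤ M` (`eBesovSupSeminorm β 4`; `B^β_{4,∞} ⊋ C^{0,β}` on the torus)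
together with the qualitative continuity of `θ₀` and of `θ(t)` for a.e. `t`. The velocity meets
the scalar only in `∫ ∇θ̄_ℓ · τ_ℓ(u,θ)`, paired `L⁴ × L^{4/3}` with
`‖τ_ℓ(u,θ)‖_{L^{4/3}} ≤ 2 [u]_{B^α_{2,∞}} ℓ^α [θ]_{B^β_{4,∞}} ℓ^β`; cf. the inviscid conservation
theorem in the scale `2/p + 1/q = 1`. [cite: DrivasEtAl2022, Thm. 4 and its proof]
[cite: AkramovWiedemann2019, Thm. 1] -/
theorem DrivasElgindiIyerJeong2022_thm4_sobolevVelocity (d : Type) [Fintype d] [DecidableEq d] (T : ℝ)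
    (hT : 0 < T) (α β : ℝ≥0) (hα : 0 < α ∧ α ≤ 1) (hβ : 0 < β ∧ β ≤ 1) (K M κ₀ : ℝ≥0) :
    ∃ C : ℝ≥0,
      ∀ (u : ℝ → UnitAddTorus d → EuclideanSpace ℝ d)
        (_hub : ∀ᵐ t ∂(volume.restrict (Ioo 0 T)), eSupNorm (u t) < ⊤)
        (_hu : MemLpBesovSup 1 (α : ℝ) 2 u volume (Ioo 0 T))
        (_huK : eLpBesovSupNorm 1 (α : ℝ) 2 u volume (Ioo 0 T) ≤ K)
        (θ₀ : UnitAddTorus d → ℝ) (_hθ₀c : Continuous θ₀)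
        (_hθ₀ : eBesovSupSeminorm (β : ℝ) 4 θ₀ volume ≤ M)
        (κ : ℝ) (_hκ : 0 < κ) (_hκ₀ : κ ≤ κ₀)
        (θ : ℝ → UnitAddTorus d → ℝ) (_hθ : Torus.IsWeakScalarTransportOn T κ u θ₀ θ)
        (_henergy : ∀ᵐ t ∂(volume.restrict (Ioo 0 T)),
          (∫⁻ x, ‖θ t x‖ₑ ^ 2) + 2 * Torus.eScalarDissipation κ θ 0 t ≤ ∫⁻ x, ‖θ₀ x‖ₑ ^ 2)
        (_hcont : ∀ᵐ t ∂(volume.restrict (Ioo 0 T)), Continuous (θ t))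
        (_hbound : ∀ᵐ t ∂(volume.restrict (Ioo 0 T)), eBesovSupSeminorm (β : ℝ) 4 (θ t) volume ≤ M),
        Torus.eScalarDissipation κ θ 0 T ≤
          ENNReal.ofReal (C * κ ^ (((α : ℝ) + 2 * β - 1) / (α + 1))) := by
  rcases eq_zero_or_pos κ₀ with hκ₀ | hκ₀
  · refine ⟨0, ?_⟩
    intro u _ _ _ θ₀ _ _ κ hκ hκκ₀
    exact absurd (hκ.trans_le hκκ₀) (by simp [hκ₀])
  -- the scale `ε = c κ^γ`
  set γ : ℝ := ((α : ℝ) + 1)⁻¹ with hγ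
  have hα1pos : (0 : ℝ) < α + 1 := by positivity
  have hγ0 : 0 ≤ γ := by positivity
  have hκ₀' : (0 : ℝ) < κ₀ := hκ₀
  set c : ℝ := 4⁻¹ * (κ₀ : ℝ) ^ (-γ) with hc
  have hc0 : 0 < c := by positivity
  set C₁ : ℝ := Torus.gradProfileMass d with hC₁
  have hC₁0 : 0 ≤ C₁ := Torus.gradProfileMass_nonneg
  set Cr : ℝ := 2⁻¹ * ((M : ℝ) ^ 2 * (c ^ (2 * (β : ℝ)) * (κ₀ : ℝ) ^ ((1 - (α : ℝ)) * γ)) +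
      (2 * (2 * Fintype.card d * C₁ * (M : ℝ) ^ 2) * K) * c ^ ((α : ℝ) + 2 * β - 1) +
      (2 * (T * (Fintype.card d * (C₁ ^ 2 * (M : ℝ) ^ 2)))) * c ^ (2 * (β : ℝ) - 2)) with hCr
  have hCr0 : 0 ≤ Cr := by positivity
  refine ⟨Cr.toNNReal, ?_⟩
  intro u hub hu huK θ₀ hθ₀c hθ₀ κ hκ hκκ₀ θ hθ henergy hcont hbound
  set ε : ℝ := c * κ ^ γ with hε_def
  have hε : 0 < ε := by positivity
  have hε' : ε ≤ 1 / 4 := by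
    have h1 : κ ^ γ ≤ (κ₀ : ℝ) ^ γ := Real.rpow_le_rpow hκ.le (by exact_mod_cast hκκ₀) hγ0
    have h2 : (κ₀ : ℝ) ^ (-γ) * (κ₀ : ℝ) ^ γ = 1 := by
      rw [Real.rpow_neg hκ₀'.le, inv_mul_cancel₀ (Real.rpow_pos_of_pos hκ₀' γ).ne']
    calc ε = 4⁻¹ * ((κ₀ : ℝ) ^ (-γ) * κ ^ γ) := by rw [hε_def, hc, mul_assoc]
      _ ≤ 4⁻¹ * ((κ₀ : ℝ) ^ (-γ) * (κ₀ : ℝ) ^ γ) := by gcongr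
      _ = 1 / 4 := by rw [h2]; norm_num
  have hraw := two_mul_eScalarDissipation_le_sobolevVelocity hT hα.1 hβ.1 hub hu huK hθ₀c hθ₀ hκ hθ
    henergy hcont hbound hε hε'
  -- optimisation in `ℓ`
  have hscale := scale_bound (β := (β : ℝ)) (2 * (2 * Fintype.card d * C₁ * (M : ℝ) ^ 2) * K)
    (2 * (T * (Fintype.card d * (C₁ ^ 2 * (M : ℝ) ^ 2)))) (by exact_mod_cast hα.2) hα1pos hκ
    (by exact_mod_cast hκκ₀) hc0 hγ (sq_nonneg (M : ℝ))
  have hreal : (M : ℝ) ^ 2 * ε ^ (2 * (β : ℝ)) +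
      2 * ((2 * Fintype.card d * C₁ * (M : ℝ) ^ 2 * ε ^ ((α : ℝ) + 2 * β - 1)) * K +
        T * (κ * (Fintype.card d * (C₁ ^ 2 * (M : ℝ) ^ 2 * ε ^ (2 * (β : ℝ) - 2))))) ≤
      2 * ((Cr.toNNReal : ℝ≥0) * κ ^ (((α : ℝ) + 2 * β - 1) / (α + 1))) := by
    rw [Real.coe_toNNReal _ hCr0, hCr]
    calc _ = (M : ℝ) ^ 2 * (c * κ ^ γ) ^ (2 * (β : ℝ)) +
          2 * (2 * Fintype.card d * C₁ * (M : ℝ) ^ 2) * K * (c * κ ^ γ) ^ ((α : ℝ) + 2 * β - 1) +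
          2 * (T * (Fintype.card d * (C₁ ^ 2 * (M : ℝ) ^ 2))) * (κ * (c * κ ^ γ) ^ (2 * (β : ℝ) - 2)) := by
          rw [hε_def]; ring
      _ ≤ _ := hscale
      _ = _ := by ring
  calc Torus.eScalarDissipation κ θ 0 T
      ≤ 2⁻¹ * (2 * Torus.eScalarDissipation κ θ 0 T) := by
        rw [← mul_assoc, ENNReal.inv_mul_cancel two_ne_zero ENNReal.ofNat_ne_top, one_mul]
    _ ≤ 2⁻¹ * ENNReal.ofReal (2 * ((Cr.toNNReal : ℝ≥0) * κ ^ (((α : ℝ) + 2 * β - 1) / (α + 1)))) := by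
        gcongr
        exact hraw.trans (ENNReal.ofReal_le_ofReal hreal)
    _ = ENNReal.ofReal ((Cr.toNNReal : ℝ≥0) * κ ^ (((α : ℝ) + 2 * β - 1) / (α + 1))) := by
        rw [ENNReal.ofReal_mul zero_le_two, ENNReal.ofReal_ofNat, ← mul_assoc,
          ENNReal.inv_mul_cancel two_ne_zero ENNReal.ofNat_ne_top, one_mul]

/-! ## Families: growing `L¹_t B^α_{2,∞}` norms, and the energy-budget form -/

/-- **Obukhov–Corrsin threshold with growing `L¹_t B^α_{2,∞}` norms of the velocity** (barrier
audit 2026-08-17, gen 13; the Sobolev-velocity corner of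
`DrivasElgindiIyerJeong2022_thm4.noAnomaly_of_growing_holderNorms`, from
`two_mul_eScalarDissipation_le_sobolevVelocity`). Let `α > 0`, `β ∈ (0,1]`, `γ ≥ 0` with
`γ(2-2β) < α+2β-1`, i.e. `β > (1-α+2γ)/(2+2γ)`. Along `κ_j > 0`, `κ_j → 0`, let `u_j` be velocity
fields bounded at a.e. time with `u_j ∈ L¹(0,T; B^α_{2,∞})`, `‖u_j‖_{L¹_tB^α_{2,∞}} ≤ K_j`,
`K_j ≤ A κ_j^{-γ}` eventually, continuous data with `[θ₀,ⱼ]_{B^β_{4,∞}} ≤ M` and weak solutions `θ_j`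
obeying the energy balance, continuous at a.e. time, with `ess sup_t [θ_j(t)]_{B^β_{4,∞}} ≤ M`. Then
`κ_j∫₀ᵀ‖∇θ_j‖²_{L²} → 0`. At `α = 1`: `β > γ/(1+γ)`. [cite: DrivasEtAl2022, proof of Thm. 4, (5.10)] -/
theorem DrivasElgindiIyerJeong2022_thm4_sobolevVelocity.noAnomaly_of_growing_norms
    (d : Type*) [Fintype d] [DecidableEq d] {T : ℝ} (hT : 0 < T) {α β : ℝ≥0} (hα : 0 < α)
    (hβ : 0 < β ∧ β ≤ 1) {γ : ℝ} (hγ : 0 ≤ γ) (hOC : γ * (2 - 2 * (β : ℝ)) < (α : ℝ) + 2 * β - 1)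
    {M : ℝ≥0} {A : ℝ} (K : ℕ → ℝ≥0) (κ : ℕ → ℝ) (hκ : ∀ j, 0 < κ j)
    (hκ₀ : Tendsto κ atTop (𝓝 0)) (hK : ∀ᶠ j in atTop, (K j : ℝ) ≤ A * κ j ^ (-γ))
    (u : ℕ → ℝ → UnitAddTorus d → EuclideanSpace ℝ d)
    (hub : ∀ j, ∀ᵐ t ∂((volume : Measure ℝ).restrict (Ioo 0 T)), eSupNorm (u j t) < ⊤)
    (hu : ∀ j, MemLpBesovSup 1 (α : ℝ) 2 (u j) volume (Ioo 0 T))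
    (huK : ∀ j, eLpBesovSupNorm 1 (α : ℝ) 2 (u j) volume (Ioo 0 T) ≤ K j)
    (θ₀ : ℕ → UnitAddTorus d → ℝ) (hθ₀c : ∀ j, Continuous (θ₀ j))
    (hθ₀ : ∀ j, eBesovSupSeminorm (β : ℝ) 4 (θ₀ j) volume ≤ M)
    (θ : ℕ → ℝ → UnitAddTorus d → ℝ)
    (hθ : ∀ j, Torus.IsWeakScalarTransportOn T (κ j) (u j) (θ₀ j) (θ j))
    (henergy : ∀ j, ∀ᵐ t ∂((volume : Measure ℝ).restrict (Ioo 0 T)),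
      (∫⁻ x, ‖θ j t x‖ₑ ^ 2) + 2 * Torus.eScalarDissipation (κ j) (θ j) 0 t ≤ ∫⁻ x, ‖θ₀ j x‖ₑ ^ 2)
    (hcont : ∀ j, ∀ᵐ t ∂((volume : Measure ℝ).restrict (Ioo 0 T)), Continuous (θ j t))
    (hbound : ∀ j, ∀ᵐ t ∂((volume : Measure ℝ).restrict (Ioo 0 T)),
      eBesovSupSeminorm (β : ℝ) 4 (θ j t) volume ≤ M) :
    Tendsto (fun j => Torus.eScalarDissipation (κ j) (θ j) 0 T) atTop (𝓝 0) := by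
  obtain ⟨s, hs, hP, hQ⟩ := GrowingNorms.exists_scale_exponent hγ (by exact_mod_cast hβ.2) hOC
  refine GrowingNorms.tendsto_zero_of_scale_bound (K := fun j => (K j : ℝ))
    (a := (M : ℝ) ^ 2) (b := 2 * Fintype.card d * Torus.gradProfileMass d * (M : ℝ) ^ 2)
    (c := Fintype.card d * (Torus.gradProfileMass d ^ 2 * (M : ℝ) ^ 2)) (T := T)
    hκ hκ₀ (fun j => NNReal.coe_nonneg _) hK
    (by have := Torus.gradProfileMass_nonneg (d := d); positivity) (by exact_mod_cast hβ.1)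
    hs hP hQ fun j ε hε hε' => ?_
  refine (two_mul_eScalarDissipation_le_sobolevVelocity hT hα hβ.1 (hub j) (hu j) (huK j)
    (hθ₀c j) (hθ₀ j) (hκ j) (hθ j) (henergy j) (hcont j) (hbound j) hε hε').trans (le_of_eq ?_)
  congr 1
  ring

/-- **The energy-budget form: no anomalous scalar dissipation above `β = γ/(1+γ)` along any
family of fields whose enstrophy budget grows like `κ^{-γ}`** (barrier audit 2026-08-17, gen 13).
Let `β ∈ (0,1]`, `γ ≥ 0` with `γ(2-2β) < 2β`, i.e. `β > γ/(1+γ)`. Along `κ_j > 0`, `κ_j → 0`, let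
`u_j` be velocity fields of the weak-solution class, bounded at a.e. time, with slices bounded in
`L²` by `U` and enstrophy budget `∫₀ᵀ (eGradNormSq (u_j t))^{1/2} dt ≤ B κ_j^{-γ}` (the spectral
`‖∇u_j(t)‖_{L²}`, finite for a.e. `t`), and let `θ_j` be weak solutions of
`∂ₜθ + u_j·∇θ = κ_jΔθ`, `θ(0) = θ₀,ⱼ`, obeying the energy balance, with `θ₀,ⱼ` and `θ_j(t)` (a.e. `t`)
continuous and bounded by `M` in `B^β_{4,∞}` (`eBesovSupSeminorm β 4`). Then
`κ_j ∫₀ᵀ ‖∇θ_j‖²_{L²} → 0`. READINGS: (i) `γ = 1/2` — any vanishing-viscosity family of Leray–Hopf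
fields, bounded at a.e. time, with energy budget `ν_j∫₀ᵀ‖∇u_j‖²₂ ≤ E₀` at fixed Prandtl number
`ν_j = Pr κ_j` (`B = (T E₀/Pr)^{1/2}`, by Cauchy–Schwarz in time): scalars bounded in
`L^∞_t B^β_{4,∞}` for some `β > 1/3` carry no anomaly — the Obukhov–Corrsin exponent `1/3` as a
rigidity threshold from the kinetic energy budget alone, the scalar counterpart of the Onsager
singularity theorem for Leray solutions; (ii) `γ = 1/4` — planar Leray–Hopf fields under one
steady force with bounded mean energy (Alexakis–Doering, §2: `⟨‖∇v‖₂²⟩ = O(ν^{-1/2})`), the regime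
of crux `ScalarAnomalySteadySourceFormal` read on windows: `β > 1/5` in `B^β_{4,∞}`, excluding
fronts of bounded jump and perimeter (`1_Ω ∈ B^{1/4}_{4,∞}`); (iii) `γ = 0` — fields bounded in
`L¹_t H¹`: every `β > 0`. Proof: `[u]_{B¹_{2,∞}} ≤ √d ‖∇u‖_{L²}`
(`SobolevCorner.eBesovSupSeminorm_one_two_le`) feeds `noAnomaly_of_growing_norms` at `α = 1` with
`K_j = TU + √d B κ_j^{-γ} ≤ (TU + √d B) κ_j^{-γ}` for `κ_j ≤ 1`.
[cite: DrivasEtAl2022, proof of Thm. 4, (5.10)] [cite: DiPernaLions1989Invent, Lemma II.1] -/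
theorem DrivasElgindiIyerJeong2022_thm4_sobolevVelocity.noAnomaly_of_enstrophyBudget
    (d : Type*) [Fintype d] [DecidableEq d] {T : ℝ} (hT : 0 < T) {β : ℝ≥0}
    (hβ : 0 < β ∧ β ≤ 1) {γ : ℝ} (hγ : 0 ≤ γ) (hOC : γ * (2 - 2 * (β : ℝ)) < 2 * β)
    {M U : ℝ≥0} {B : ℝ} (hB0 : 0 ≤ B) (κ : ℕ → ℝ) (hκ : ∀ j, 0 < κ j) (hκ₀ : Tendsto κ atTop (𝓝 0))
    (u : ℕ → ℝ → UnitAddTorus d → EuclideanSpace ℝ d)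
    (hub : ∀ j, ∀ᵐ t ∂((volume : Measure ℝ).restrict (Ioo 0 T)), eSupNorm (u j t) < ⊤)
    (hU : ∀ j, ∀ᵐ t ∂((volume : Measure ℝ).restrict (Ioo 0 T)), eLpNorm (u j t) 2 volume ≤ U)
    (hG : ∀ j, ∀ᵐ t ∂((volume : Measure ℝ).restrict (Ioo 0 T)), Torus.eGradNormSq (u j t) < ⊤)
    (hB : ∀ j, ∫⁻ t in Ioo 0 T, Torus.eGradNormSq (u j t) ^ (1 / 2 : ℝ) ≤ ENNReal.ofReal (B * κ j ^ (-γ)))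
    (θ₀ : ℕ → UnitAddTorus d → ℝ) (hθ₀c : ∀ j, Continuous (θ₀ j))
    (hθ₀ : ∀ j, eBesovSupSeminorm (β : ℝ) 4 (θ₀ j) volume ≤ M)
    (θ : ℕ → ℝ → UnitAddTorus d → ℝ)
    (hθ : ∀ j, Torus.IsWeakScalarTransportOn T (κ j) (u j) (θ₀ j) (θ j))
    (henergy : ∀ j, ∀ᵐ t ∂((volume : Measure ℝ).restrict (Ioo 0 T)),
      (∫⁻ x, ‖θ j t x‖ₑ ^ 2) + 2 * Torus.eScalarDissipation (κ j) (θ j) 0 t ≤ ∫⁻ x, ‖θ₀ j x‖ₑ ^ 2)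
    (hcont : ∀ j, ∀ᵐ t ∂((volume : Measure ℝ).restrict (Ioo 0 T)), Continuous (θ j t))
    (hbound : ∀ j, ∀ᵐ t ∂((volume : Measure ℝ).restrict (Ioo 0 T)),
      eBesovSupSeminorm (β : ℝ) 4 (θ j t) volume ≤ M) :
    Tendsto (fun j => Torus.eScalarDissipation (κ j) (θ j) 0 T) atTop (𝓝 0) := by
  set D : ℝ := Real.sqrt (Fintype.card d) with hD
  have hD0 : 0 ≤ D := Real.sqrt_nonneg _
  -- the budgets `K_j = T U + √d B κ_j^{-γ}`
  have hKj0 : ∀ j, 0 ≤ T * U + D * (B * κ j ^ (-γ)) := fun j => by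
    have := (hκ j).le
    positivity
  set K : ℕ → ℝ≥0 := fun j => (T * U + D * (B * κ j ^ (-γ))).toNNReal with hKdef
  have hKcoe : ∀ j, ((K j : ℝ≥0) : ℝ) = T * U + D * (B * κ j ^ (-γ)) := fun j =>
    Real.coe_toNNReal _ (hKj0 j)
  -- eventually `κ_j ≤ 1`, where `K_j ≤ (T U + √d B) κ_j^{-γ}`
  have hev : ∀ᶠ j in atTop, κ j ≤ 1 := (hκ₀.eventually (Iic_mem_nhds one_pos)).mono fun j hj => hj
  have hK : ∀ᶠ j in atTop, (K j : ℝ) ≤ (T * U + D * B) * κ j ^ (-γ) := by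
    filter_upwards [hev] with j hj
    have h1 : (1 : ℝ) ≤ κ j ^ (-γ) :=
      Real.one_le_rpow_of_pos_of_le_one_of_nonpos (hκ j) hj (by linarith)
    rw [hKcoe]
    have hTU : 0 ≤ T * (U : ℝ) := by have := hT.le; positivity
    nlinarith [mul_nonneg hTU (sub_nonneg.2 h1)]
  -- `u_j ∈ L¹_t B¹_{2,∞}` with `‖u_j‖ ≤ K_j`
  have hslice : ∀ j, ∀ᵐ t ∂((volume : Measure ℝ).restrict (Ioo 0 T)),
      MemBesovSup 1 2 (u j t) volume ∧
        eBesovSupNorm 1 2 (u j t) volume ≤ U + ENNReal.ofReal D * Torus.eGradNormSq (u j t) ^ (1 / 2 : ℝ) := by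
    intro j
    filter_upwards [hub j, hU j, hG j, (hθ j).ae_aestronglyMeasurable_velocity_slice] with t hb hU2 hGt hm
    have hCv : ∀ y, ‖u j t y‖ ≤ (eSupNorm (u j t)).toReal := fun y => by
      rw [← toReal_enorm]
      exact ENNReal.toReal_mono hb.ne (enorm_le_eSupNorm (u j t) y)
    have h2 : MemLp (u j t) 2 volume :=
      (memLp_top_of_bound hm _ (Eventually.of_forall hCv)).mono_exponent le_top
    have hsemi := SobolevCorner.eBesovSupSeminorm_one_two_le h2
    have hsemitop : eBesovSupSeminorm 1 2 (u j t) volume < ⊤ :=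
      lt_of_le_of_lt hsemi (ENNReal.mul_lt_top ENNReal.ofReal_lt_top
        (ENNReal.rpow_lt_top_of_nonneg (by norm_num) hGt.ne))
    exact ⟨⟨h2, hsemitop⟩, add_le_add hU2 hsemi⟩
  have hnorm : ∀ j, eLpBesovSupNorm 1 1 2 (u j) volume (Ioo 0 T) ≤ K j := by
    intro j
    rw [eLpBesovSupNorm, eLpNorm_one_eq_lintegral_enorm]
    calc ∫⁻ t in Ioo 0 T, ‖(eBesovSupNorm 1 2 (u j t) volume).toReal‖ₑ
        ≤ ∫⁻ t in Ioo 0 T, ((U : ℝ≥0∞) + ENNReal.ofReal D * Torus.eGradNormSq (u j t) ^ (1 / 2 : ℝ)) := by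
          refine lintegral_mono_ae ((hslice j).mono fun t ht => ?_)
          rw [Real.enorm_eq_ofReal ENNReal.toReal_nonneg]
          exact ENNReal.ofReal_toReal_le.trans ht.2
      _ = (U : ℝ≥0∞) * ENNReal.ofReal T +
            ENNReal.ofReal D * ∫⁻ t in Ioo 0 T, Torus.eGradNormSq (u j t) ^ (1 / 2 : ℝ) := by
          rw [lintegral_add_left measurable_const, lintegral_const_mul' _ _ ENNReal.ofReal_ne_top,
            lintegral_const, Measure.restrict_apply_univ, Real.volume_Ioo, sub_zero]
      _ ≤ (U : ℝ≥0∞) * ENNReal.ofReal T + ENNReal.ofReal D * ENNReal.ofReal (B * κ j ^ (-γ)) := by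
          gcongr
          exact hB j
      _ = (K j : ℝ≥0∞) := by
          rw [← ENNReal.ofReal_coe_nnreal (p := K j), hKcoe, ENNReal.ofReal_add (by have := hT.le; positivity)
            (mul_nonneg hD0 (mul_nonneg hB0 (Real.rpow_nonneg (hκ j).le _))),
            ENNReal.ofReal_mul hT.le, ENNReal.ofReal_coe_nnreal, ENNReal.ofReal_mul hD0,
            mul_comm (ENNReal.ofReal T) (U : ℝ≥0∞)]
  have hmem : ∀ j, MemLpBesovSup 1 ((1 : ℝ≥0) : ℝ) 2 (u j) volume (Ioo 0 T) := fun j =>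
    ⟨by simpa using (hslice j).mono fun t ht => ht.1,
      lt_of_le_of_lt (by simpa using hnorm j) ENNReal.coe_lt_top⟩
  have hOC' : γ * (2 - 2 * (β : ℝ)) < ((1 : ℝ≥0) : ℝ) + 2 * β - 1 := by push_cast; linarith
  exact DrivasElgindiIyerJeong2022_thm4_sobolevVelocity.noAnomaly_of_growing_norms d hT one_pos hβ hγ
    hOC' K κ hκ hκ₀ hK u hub hmem (fun j => by simpa using hnorm j) θ₀ hθ₀c hθ₀ θ hθ henergy hcont hbound

end Literature.Barriers.AnomalousDissipation

end
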